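import Mathlib.MeasureTheory.Measure.GiryMonad
import Mathlib.Topology.MetricSpace.ThickenedIndicator
import Summits.AtomisticToContinuum.HydrodynamicLimit.Theorems.OneFlightGossipEngineEnergyCurrentTailsLevelCensusObjects
import Literature.Analysis.FluidPDE.EmpiricalCollisionMeasureMeasurableLabels
import HarnessLib

/-!
# Velocity-event counts along the hard-sphere flow are measurable in the datum (stub A (iv) of
# the line `level-census-comparison`, crux `EnergyCurrentTails`, stmt-AtomisticToContinuum-9235)

Helper file of the registered stub `stub_censusLedger : CensusLedger` (objects and statement in
`…Theorems.OneFlightGossipEngineEnergyCurrentTailsLevelCensusObjects`).  It proves part (iv) of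
`CensusLedger` in the stronger MEASURABLE form (registered helper `censusLedger_eventMeasurable`):
for `0 < σ < 1/2`, every `N`, every flow `Φ : Flow σ N`, every window `(s, s']` and every BOREL
set `S` of velocity events `((v₁⁻, v₂⁻), (v₁⁺, v₂⁺))`, the once-per-collision count
`eventSum Φ s s' S : z ↦ #{collisions of the orbit of z in (s, s'] with velocity event in S}`,
extended by `0` off the good set, is measurable; hence a.e.-measurable under every law carried by
the good set (`aemeasurable_eventSum`; the local Gibbs laws, `ae_mem_good_localGibbsLaw`).

**Proof.**  (1) On the collisions of an orbit the post-collisional velocities are a POLYNOMIAL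
function of the collision mark `(t, x, ω, v⁻, w⁻)`: `v⁺ = v⁻ − ⟪v⁻ − w⁻, ω⟫ ω`,
`w⁺ = w⁻ + ⟪v⁻ − w⁻, ω⟫ ω` (`reflectVel` is an involution, scale invariant, and `‖ω‖ = 1` at
contact), so by `collisionSum_congr` the guarded sum of `f (v⁻, v⁺)` is, on the good set, a
label-dependent collision sum of `F i j (mark) = 𝟙{i < j} f (ψ mark)` with `ψ` continuous.
(2) For CONTINUOUS `f : VelEvent → ℝ≥0∞` the engine
`HardSphereFlow.measurable_indicator_of_eqOn_collisionSum_labels` (velocity-jump detection over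
dyadic cells, `EmpiricalCollisionMeasureMeasurableLabels`; regular measurable torus geometry for
`hsDiameter σ N ≤ σ < 1/2`) gives measurability.  (3) For a CLOSED set `C` the indicator `𝟙_C` is
the pointwise limit of the continuous thickened indicators (`thickenedIndicatorAux`,
`thickenedIndicatorAux_tendsto_indicator_closure`); on the good set the collision sum is a finite
sum, so the counts converge and `ENNReal.measurable_of_tendsto` applies.  (4) For fixed `z` the
map `S ↦ 𝟙_good(z) · eventSum Φ s s' S z` is a finite measure (a finite sum of Dirac masses at the
velocity events); closed sets form a π-system generating the Borel σ-algebra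
(`borel_eq_generateFrom_isClosed`), so `Measurable.measure_of_isPiSystem` (Dynkin's π-λ theorem
for measure-valued maps, Giry monad) upgrades (3) to every Borel `S`.

References: Gallagher–Saint-Raymond–Texier 2013 §4.1 (collision marks of the hard-sphere flow);
Cercignani–Illner–Pulvirenti 1994 §4.2 (elastic reflection law).
-/

noncomputable section

open MeasureTheory Set Filter
open scoped ENNReal InnerProductSpace Topology

namespace Summit.AtomisticToContinuum.HydrodynamicLimit.Theorems.EnergyCurrentTailsLevelCensus

open Literature.MathematicalPhysics.KineticTheory Literature.Analysis.FluidPDE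

/-! ## The post-collisional velocities as a polynomial function of the mark -/

/-- **The elastic law read off the record.**  At an ordered contact pair `(i, j)` of a
configuration in contact (`0 < ε`), with `ω` the recorded (unit) impact vector and `(v, w)` the
recorded pre-collisional velocities, the post-collisional velocities of the record are
`(v − ⟪v − w, ω⟫ ω, w + ⟪v − w, ω⟫ ω)`: `reflectVel` is a scale-invariant involution
(`reflectVel_smul`, `reflectVel_reflectVel`) and `‖ω‖ = 1` (`norm_ofConfig_impactVec`).
[folklore] -/
theorem ofConfig_postVel_eq_of_mem_contactSet {ε : ℝ} (hε : 0 < ε) {n : ℕ}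
    {z : Config n (Fin 3) T3} (t : ℝ) {i j : Fin n}
    (hc : z ∈ contactSet (Torus.geometry (Fin 3)) n ε i j) :
    (HardSphereCollisionRecord.ofConfig (Torus.geometry (Fin 3)) ε z t i j).postVel =
      ((HardSphereCollisionRecord.ofConfig (Torus.geometry (Fin 3)) ε z t i j).preVel.1 -
          ⟪(HardSphereCollisionRecord.ofConfig (Torus.geometry (Fin 3)) ε z t i j).preVel.1 -
              (HardSphereCollisionRecord.ofConfig (Torus.geometry (Fin 3)) ε z t i j).preVel.2,
            (HardSphereCollisionRecord.ofConfig (Torus.geometry (Fin 3)) ε z t i j).impactVec⟫_ℝ •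
            (HardSphereCollisionRecord.ofConfig (Torus.geometry (Fin 3)) ε z t i j).impactVec,
        (HardSphereCollisionRecord.ofConfig (Torus.geometry (Fin 3)) ε z t i j).preVel.2 +
          ⟪(HardSphereCollisionRecord.ofConfig (Torus.geometry (Fin 3)) ε z t i j).preVel.1 -
              (HardSphereCollisionRecord.ofConfig (Torus.geometry (Fin 3)) ε z t i j).preVel.2,
            (HardSphereCollisionRecord.ofConfig (Torus.geometry (Fin 3)) ε z t i j).impactVec⟫_ℝ •
            (HardSphereCollisionRecord.ofConfig (Torus.geometry (Fin 3)) ε z t i j).impactVec) := by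
  have hω :
      ‖(HardSphereCollisionRecord.ofConfig (Torus.geometry (Fin 3)) ε z t i j).impactVec‖ = 1 :=
    HardSphereCollisionRecord.norm_ofConfig_impactVec hε t hc
  have key : reflectVel
      (HardSphereCollisionRecord.ofConfig (Torus.geometry (Fin 3)) ε z t i j).impactVec
      (HardSphereCollisionRecord.ofConfig (Torus.geometry (Fin 3)) ε z t i j).preVel =
      (HardSphereCollisionRecord.ofConfig (Torus.geometry (Fin 3)) ε z t i j).postVel := by
    rw [HardSphereCollisionRecord.ofConfig_impactVec, reflectVel_smul (inv_ne_zero hε.ne'),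
      HardSphereCollisionRecord.ofConfig_preVel, reflectVel_reflectVel,
      HardSphereCollisionRecord.ofConfig_postVel]
  rw [← key]
  simp only [reflectVel, hω, one_pow, div_one]

/-- **Guarded velocity-event functionals are label-dependent mark functionals.**
Along the orbit of any datum (`0 < σ`, so `0 < hsDiameter σ N`), for every `f` on velocity
events the once-per-collision sum of `f (v⁻, v⁺)` equals the collision sum of
`𝟙{fst < snd} f (ψ mark)` with the polynomial
`ψ (t, x, ω, v, w) = ((v, w), (v − ⟪v−w, ω⟫ω, w + ⟪v−w, ω⟫ω))` (`collisionSum_congr`,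
`ofConfig_postVel_eq_of_mem_contactSet`). [folklore] -/
theorem collisionSum_guard_eq_mark {M : Type*} [AddCommMonoid M] {σ : ℝ} (hσ : 0 < σ) {N : ℕ}
    (Φ : Flow σ N) (f : VelEvent → M) (S : Set ℝ) (z : Config (N + 1) (Fin 3) T3) :
    Φ.collisionSum S (fun c => if c.fst < c.snd then f (c.preVel, c.postVel) else 0) z =
      Φ.collisionSum S (fun c => (fun (i j : Fin (N + 1)) (m : ℝ × T3 × V3 × V3 × V3) =>
        if i < j then f ((m.2.2.2.1, m.2.2.2.2),
          (m.2.2.2.1 - ⟪m.2.2.2.1 - m.2.2.2.2, m.2.2.1⟫_ℝ • m.2.2.1,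
            m.2.2.2.2 + ⟪m.2.2.2.1 - m.2.2.2.2, m.2.2.1⟫_ℝ • m.2.2.1)) else 0)
        c.fst c.snd c.mark) z := by
  rw [HardSphereFlow.collisionSum_eq, HardSphereFlow.collisionSum_eq]
  refine collisionSum_congr fun t _ p hp => ?_
  obtain ⟨-, hc⟩ := mem_contactPairs.1 hp
  simp only [HardSphereCollisionRecord.ofConfig_fst, HardSphereCollisionRecord.ofConfig_snd,
    HardSphereCollisionRecord.mark_def, Prod.mk.eta]
  by_cases hlt : p.1 < p.2
  · rw [if_pos hlt, if_pos hlt,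
      ofConfig_postVel_eq_of_mem_contactSet (hsDiameter_pos hσ N) t hc]
  · rw [if_neg hlt, if_neg hlt]

/-! ## Continuous, then closed, then Borel -/

section Flow

variable {σ : ℝ} {N : ℕ}

/-- **Continuous functionals.**  For `0 < σ < 1/2` and a CONTINUOUS `f : VelEvent → ℝ≥0∞`, the
once-per-collision sum `z ↦ Σ 𝟙{fst < snd} f (v⁻, v⁺)` over `(s, s']`, extended by `0` off the good
set, is measurable: the engine `HardSphereFlow.measurable_indicator_of_eqOn_collisionSum_labels`
(regular measurable torus geometry, `hsDiameter σ N ≤ σ < 1/2`) applied to the continuous family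
`𝟙{i < j} f ∘ ψ` of `collisionSum_guard_eq_mark`. [folklore] -/
theorem measurable_indicator_collisionSum_guard (hσ : 0 < σ) (hσ2 : σ < 1 / 2) (Φ : Flow σ N)
    {f : VelEvent → ℝ≥0∞} (hf : Continuous f) (s s' : ℝ) :
    Measurable (Φ.good.indicator fun z =>
      Φ.collisionSum (Ioc s s')
        (fun c => if c.fst < c.snd then f (c.preVel, c.postVel) else 0) z) := by
  have hε : hsDiameter σ N < 2⁻¹ := (hsDiameter_le hσ.le N).trans_lt (by linarith)
  have hψ : Continuous fun m : ℝ × T3 × V3 × V3 × V3 => (((m.2.2.2.1, m.2.2.2.2),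
      (m.2.2.2.1 - ⟪m.2.2.2.1 - m.2.2.2.2, m.2.2.1⟫_ℝ • m.2.2.1,
        m.2.2.2.2 + ⟪m.2.2.2.1 - m.2.2.2.2, m.2.2.1⟫_ℝ • m.2.2.1)) : VelEvent) := by
    fun_prop
  have hFc : ∀ i j : Fin (N + 1), Continuous fun m : ℝ × T3 × V3 × V3 × V3 =>
      if i < j then f ((m.2.2.2.1, m.2.2.2.2),
        (m.2.2.2.1 - ⟪m.2.2.2.1 - m.2.2.2.2, m.2.2.1⟫_ℝ • m.2.2.1,
          m.2.2.2.2 + ⟪m.2.2.2.1 - m.2.2.2.2, m.2.2.1⟫_ℝ • m.2.2.1)) else 0 := by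
    intro i j
    by_cases hij : i < j
    · simp only [if_pos hij]
      exact hf.comp hψ
    · simp only [if_neg hij]
      exact continuous_const
  exact Φ.measurable_indicator_of_eqOn_collisionSum_labels (Torus.isHardSphereRegular_geometry hε)
    Torus.isMeasurable_geometry hFc (fun i j => (hFc i j).measurable) s s'
    fun z _ => collisionSum_guard_eq_mark hσ Φ f (Ioc s s') z

/-- **Closed events.**  For a CLOSED set `C` of velocity events, `𝟙_good · eventSum Φ s s' C` is
measurable: `𝟙_C` is the pointwise limit of the continuous thickened indicators
`thickenedIndicatorAux (1/(n+1)) C` (`thickenedIndicatorAux_tendsto_indicator_closure`), the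
collision sum of a good datum is a finite sum (`collisionSum_eq_finset_sum`), so the guarded sums
converge pointwise, and `ENNReal.measurable_of_tendsto` concludes from
`measurable_indicator_collisionSum_guard`. [folklore] -/
theorem measurable_indicator_eventSum_of_isClosed (hσ : 0 < σ) (hσ2 : σ < 1 / 2) (Φ : Flow σ N)
    (s s' : ℝ) {C : Set VelEvent} (hC : IsClosed C) :
    Measurable (Φ.good.indicator (eventSum Φ s s' C)) := by
  have hδpos : ∀ n : ℕ, (0 : ℝ) < 1 / ((n : ℝ) + 1) := fun n => by positivity
  have hδ : Tendsto (fun n : ℕ => 1 / ((n : ℝ) + 1)) atTop (𝓝 0) :=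
    tendsto_one_div_add_atTop_nhds_zero_nat
  have hlim := thickenedIndicatorAux_tendsto_indicator_closure hδ C
  rw [hC.closure_eq, tendsto_pi_nhds] at hlim
  refine ENNReal.measurable_of_tendsto (f := fun n => Φ.good.indicator fun z =>
      Φ.collisionSum (Ioc s s') (fun c => if c.fst < c.snd then
        thickenedIndicatorAux (1 / ((n : ℝ) + 1)) C (c.preVel, c.postVel) else 0) z)
    (fun n => measurable_indicator_collisionSum_guard hσ hσ2 Φ
      (continuous_thickenedIndicatorAux (hδpos n) C) s s') ?_
  rw [tendsto_pi_nhds]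
  intro z
  by_cases hz : z ∈ Φ.good
  · simp only [indicator_of_mem hz, eventSum, HardSphereFlow.collisionSum_eq]
    have hfin := Φ.finite_collisionTimes_inter hz (S := Ioc s s') Ioc_subset_Icc_self
    simp only [collisionSum_eq_finset_sum hfin]
    refine tendsto_finsetSum _ fun t _ => tendsto_finsetSum _ fun p _ => ?_
    by_cases hlt : (HardSphereCollisionRecord.ofConfig (Torus.geometry (Fin 3)) (hsDiameter σ N)
        (Φ.flow t z) t p.1 p.2).fst <
        (HardSphereCollisionRecord.ofConfig (Torus.geometry (Fin 3)) (hsDiameter σ N)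
          (Φ.flow t z) t p.1 p.2).snd
    · simp only [if_pos hlt]
      exact hlim _
    · simp only [if_neg hlt]
      exact tendsto_const_nhds
  · simp only [indicator_of_notMem hz]
    exact tendsto_const_nhds

/-- Evaluating a measure-valued collision sum at a set commutes with the (finite) sum.
[folklore] -/
theorem collisionSum_measure_apply {α : Type*} [MeasurableSpace α] {d X : Type*} [Fintype d]
    {n : ℕ} {G : Geometry d X} {ε : ℝ} {γ : ℝ → Config n d X} {S : Set ℝ}
    (hfin : (collisionTimes G ε γ ∩ S).Finite) (F : HardSphereCollisionRecord d X n → Measure α)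
    (A : Set α) :
    collisionSum G ε γ S F A = collisionSum G ε γ S (fun c => F c A) := by
  rw [collisionSum_eq_finset_sum hfin, collisionSum_eq_finset_sum hfin]
  simp only [Measure.coe_finsetSum, Finset.sum_apply]

/-- **The event measure of a datum.**  `ν_z = 𝟙_good(z) Σ_{collisions, fst < snd} δ_{(v⁻, v⁺)}`
evaluated at a measurable `S` is `𝟙_good(z) · eventSum Φ s s' S z`. [folklore] -/
theorem eventMeasure_apply (Φ : Flow σ N) (s s' : ℝ) (z : Config (N + 1) (Fin 3) T3)
    {S : Set VelEvent} (hS : MeasurableSet S) :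
    Φ.good.indicator (fun z => Φ.collisionSum (Ioc s s')
        (fun c => if c.fst < c.snd then Measure.dirac (c.preVel, c.postVel) else 0) z) z S =
      Φ.good.indicator (eventSum Φ s s' S) z := by
  by_cases hz : z ∈ Φ.good
  · have hfin := Φ.finite_collisionTimes_inter hz (S := Ioc s s') Ioc_subset_Icc_self
    rw [indicator_of_mem hz, indicator_of_mem hz, eventSum, HardSphereFlow.collisionSum_eq,
      HardSphereFlow.collisionSum_eq, collisionSum_measure_apply hfin]
    refine collisionSum_congr fun t _ p _ => ?_
    split_ifs
    · rw [Measure.dirac_apply' _ hS]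
      rfl
    · rfl
  · rw [indicator_of_notMem hz, indicator_of_notMem hz]
    rfl

/-- On every datum the velocity-event count of the whole event space is finite (a finite sum of
zeros and ones on the good set, zero off it). [folklore] -/
theorem indicator_eventSum_univ_lt_top (Φ : Flow σ N) (s s' : ℝ) (z : Config (N + 1) (Fin 3) T3) :
    Φ.good.indicator (eventSum Φ s s' univ) z < ∞ := by
  by_cases hz : z ∈ Φ.good
  · have hfin := Φ.finite_collisionTimes_inter hz (S := Ioc s s') Ioc_subset_Icc_self
    rw [indicator_of_mem hz, eventSum, HardSphereFlow.collisionSum_eq,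
      collisionSum_eq_finset_sum hfin]
    refine ENNReal.sum_lt_top.2 fun t _ => ENNReal.sum_lt_top.2 fun p _ => ?_
    split_ifs
    · rw [indicator_of_mem (mem_univ _)]
      exact ENNReal.one_lt_top
    · exact ENNReal.zero_lt_top
  · rw [indicator_of_notMem hz]
    exact ENNReal.zero_lt_top

/-- **From closed events to Borel events** (Dynkin's π-λ theorem in its Giry-monad form
`Measurable.measure_of_isPiSystem`): if a family `ν_z` of finite measures on velocity events
satisfies `ν_z S = 𝟙_good(z) · eventSum Φ s s' S z` for measurable `S`, and these counts are
measurable in `z` for CLOSED `S` (a π-system generating the Borel σ-algebra,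
`borel_eq_generateFrom_isClosed`), then `z ↦ ν_z` is measurable, hence so is every count of a
Borel event. [folklore] -/
theorem measurable_indicator_eventSum_of_measure (Φ : Flow σ N) (s s' : ℝ)
    (ν : Config (N + 1) (Fin 3) T3 → Measure VelEvent) [∀ z, IsFiniteMeasure (ν z)]
    (hν : ∀ (z : Config (N + 1) (Fin 3) T3) (S : Set VelEvent), MeasurableSet S →
      ν z S = Φ.good.indicator (eventSum Φ s s' S) z)
    (hclosed : ∀ C : Set VelEvent, IsClosed C → Measurable (Φ.good.indicator (eventSum Φ s s' C)))
    {S : Set VelEvent} (hS : MeasurableSet S) :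
    Measurable (Φ.good.indicator (eventSum Φ s s' S)) := by
  have hgen : (inferInstance : MeasurableSpace VelEvent) =
      MeasurableSpace.generateFrom {C : Set VelEvent | IsClosed C} := by
    rw [← borel_eq_generateFrom_isClosed]
    exact BorelSpace.measurable_eq
  have hfun : ∀ C : Set VelEvent, MeasurableSet C →
      (fun z => ν z C) = Φ.good.indicator (eventSum Φ s s' C) :=
    fun C hC => funext fun z => hν z C hC
  have hmeas : Measurable ν := by
    refine Measurable.measure_of_isPiSystem hgen isPiSystem_isClosed (fun C hC => ?_) ?_
    · rw [hfun C (IsClosed.measurableSet hC)]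
      exact hclosed C hC
    · rw [hfun univ MeasurableSet.univ]
      exact hclosed univ isClosed_univ
  rw [← hfun S hS]
  exact (Measure.measurable_coe hS).comp hmeas

/-- **Registered helper `censusLedger_eventMeasurable` — stub A (iv), measurable form.**  For
`0 < σ < 1/2`, every `N`, every flow `Φ` of the crux frame, every window `(s, s']` and every Borel
set `S` of velocity events, the once-per-collision velocity-event count `eventSum Φ s s' S`,
extended by `0` off the good set, is measurable in the initial datum (continuous functionals by
the dyadic velocity-jump engine, closed events by thickened indicators, Borel events by the π-λ
theorem applied to the event measures `ν_z = Σ δ_{(v⁻, v⁺)}`). [folklore] -/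
theorem censusLedger_eventMeasurable :
    ∀ (σ : ℝ), 0 < σ → σ < 1 / 2 → ∀ (N : ℕ) (Φ : Flow σ N) (s s' : ℝ) (S : Set VelEvent),
      MeasurableSet S → Measurable (Φ.good.indicator (eventSum Φ s s' S)) := by
  intro σ hσ hσ2 N Φ s s' S hS
  let ν : Config (N + 1) (Fin 3) T3 → Measure VelEvent := fun z =>
    Φ.good.indicator (fun z => Φ.collisionSum (Ioc s s')
      (fun c => if c.fst < c.snd then Measure.dirac (c.preVel, c.postVel) else 0) z) z
  have hν : ∀ (z : Config (N + 1) (Fin 3) T3) (T : Set VelEvent), MeasurableSet T →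
      ν z T = Φ.good.indicator (eventSum Φ s s' T) z :=
    fun z T hT => eventMeasure_apply Φ s s' z hT
  haveI : ∀ z, IsFiniteMeasure (ν z) := fun z =>
    ⟨by rw [hν z univ MeasurableSet.univ]; exact indicator_eventSum_univ_lt_top Φ s s' z⟩
  exact measurable_indicator_eventSum_of_measure Φ s s' ν hν
    (fun C hC => measurable_indicator_eventSum_of_isClosed hσ hσ2 Φ s s' hC) hS

/-- **A.e.-measurability of the velocity-event counts** under every law carried by the good set
(e.g. the local Gibbs laws `λ_N`, `ae_mem_good_localGibbsLaw`): the form consumed by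
`CensusLedger` (iv). [folklore] -/
theorem aemeasurable_eventSum (hσ : 0 < σ) (hσ2 : σ < 1 / 2) (Φ : Flow σ N) (s s' : ℝ)
    {S : Set VelEvent} (hS : MeasurableSet S) {μ : Measure (Config (N + 1) (Fin 3) T3)}
    (hμ : ∀ᵐ z ∂μ, z ∈ Φ.good) : AEMeasurable (eventSum Φ s s' S) μ := by
  refine ⟨_, censusLedger_eventMeasurable σ hσ hσ2 N Φ s s' S hS, ?_⟩
  filter_upwards [hμ] with z hz
  exact (indicator_of_mem hz _).symm

end Flow

end Summit.AtomisticToContinuum.HydrodynamicLimit.Theorems.EnergyCurrentTailsLevelCensus
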